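import Summits.BirchSwinnertonDyer.BirchSwinnertonDyer.Theorems.ClassRecordThreeCornerAtThreeUpperCoChainTight
import Summits.BirchSwinnertonDyer.BirchSwinnertonDyer.Theorems.ClassRecordThreeCornerAtThreeCoChainDefs
import Summits.BirchSwinnertonDyer.Rank1Residual.X11b.Three.CornerMatarNekovar
import HarnessLib

/-!
# Route `ClassRecordThree` (rung K2@3), crux 7 `CornerAtThree` (item stmt-BirchSwinnertonDyer-19111, shared with
# `KolyvaginRoadThree`), stub `stub_cornerUpper3` — the co-chain road, file 4: BY NAME — `Theorems.CornerAtThreeUpper`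
# ⟸ `Theorems.CornerAtThreeCoStepL` + cited facts, the converse (with Matar–Nekovář on `3 ∤ ∏c`), and
# «conjunct 1 ∧ co-conjunct = the main conjecture EQUALITY at 𝟙 on the corner frames»
# (cell `bsd-stepL`, width-lever second lane `bsd-stepL-corner3-p2`; `--supports stmt-BirchSwinnertonDyer-19111`)

HONEST FRAMING: theorems only (no definition, no named fact, no `sorry`); CONDITIONAL on cited Literature facts taken
BY NAME and on the OPEN typed input `Three.CornerCoStepLAt` (definitions home
`Theorems/ClassRecordThreeCornerAtThreeCoChainDefs.lean`, p530129); nothing is asserted about any curve; item 19111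
stays open; BSD is not advanced; no census word, tier or label moves (T7).

## What this file proves (the by-name form of files 1–3: p527420, p528380, p529295)

* **`Three.cornerUpperAt_of_cornerCoStepLAt_of_facts`** — `Three.CornerCoStepLAt W` (the Kolyvagin-system «⊇» half
  of the anticyclotomic BDP main conjecture at `𝟙` on the corner frames, BY NAME) + four cited facts (GZK, newforms,
  Poitou–Tate ×2: the control identity) ⟹ `Three.CornerUpperAt W`;
  **`Three.cornerAtThreeUpper_of_cornerAtThreeCoStepL_of_facts`** — the registered stub's constant
  `Theorems.CornerAtThreeUpper` ⟸ the constant `Theorems.CornerAtThreeCoStepL` + the four facts. THE READING OF RECORD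
  of `stub_cornerUpper3` along the co-chain: ONE typed open input.
* `Three.cornerCoStepLAt_of_cornerUpperAt_of_facts` — the converse on ALL corner frames: on `3 ∣ ∏c` by tightness
  (file 3), on `3 ∤ ∏c` from the PRINTED irreducible-image Kolyvagin bound (Matar–Nekovář 2019 Thm. 0.3, named fact
  `MatarNekovar2019.thm03_padicValNat_card_sha_le_of_irreducible`, image-free) — there the Tamagawa term vanishes and
  the unsharp bound is the sharp one; `Three.cornerCoStepLAt_iff_cornerUpperAt_of_facts` — the `iff` modulo eight
  cited facts.
* `Three.cornerStepL_and_coStepL_iff_imcWaldspurger` — `CornerStepLAt W ∧ CornerCoStepLAt W` ⟺ at every corner frame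
  route R1's EQUALITY link `IMCWaldspurgerOnTreeAt 3 κ 𝔭 γ embAt P` (`ord₃ f_ac(0) = 2(ord₃ log_ω P − 1)`): on the
  corner, conjunct 1 of the crux (x11b3) and this lane's co-conjunct are the two inclusions of ONE anticyclotomic
  main conjecture at `𝟙`. Pure logic over `imcWaldspurgerOnTreeAt_iff_lower_and_upper`.

References: [Castella2018] Thm. 2.3, Thm. 3.2, §5 (5.1)–(5.2) (arXiv:1704.06608 pp. 5, 9, 12); [JetchevSkinnerWan2017]
§7.4.2; [MatarNekovar2019] Thm. 0.3, §0.11; [Howard2004] Thm. B (shape); [GrossLMS1991] §2 Conj. (2.2).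
-/

noncomputable section

open scoped Classical

open WeierstrassCurve NumberField IsDedekindDomain Field Literature.NumberTheory.EllipticCurves
  Literature.NumberTheory.EllipticCurves.ModularForms
  Literature.NumberTheory.EllipticCurves.GreenbergSelmer
  Literature.NumberTheory.GaloisRepresentations Literature.NumberTheory.GaloisCohomology
  Literature.NumberTheory.EllipticCurves.Rank1Residual
  Literature.NumberTheory.EllipticCurves.Rank1Residual.Typed
  Literature.NumberTheory.QuadraticFields.Quadratic
  Summit.BirchSwinnertonDyer.Rank1Residual
  Summit.BirchSwinnertonDyer.Rank1Residual.X11b.AcSelmer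

namespace Summit.BirchSwinnertonDyer.Rank1Residual.X11b.Three

variable (W : WeierstrassCurve ℚ) [W.IsElliptic] [W.IsGloballyMinimal]

/-! ### §1. The stub BY NAME from the named open input -/

/-- **`Three.CornerCoStepLAt W` + four cited facts ⟹ `Three.CornerUpperAt W`.** The named «⊇» half at `𝟙` on the
corner frames (which carries no `3 ∣ ∏c` binder) feeds file 2's `cornerUpperAt_of_coIMC_of_facts`; the control
identity is the theorem `cornerControlOnTree_of_facts`. CONDITIONAL on the open input and the cited facts.
[cite: JetchevSkinnerWan2017, §7.4.2 (eq:shaupper) (arXiv:1512.06894 p. 31)] [cite: Castella2018, Thm. 2.3 (p. 5), Thm. 3.2 (p. 9)] -/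
theorem cornerUpperAt_of_cornerCoStepLAt_of_facts [Fact (Nat.Prime 3)]
    (hGZK : rank_eq_analyticRank_of_analyticRank_le_one) (hnf : exists_isNewformOf)
    (hPT : ∀ (K : Type) [Field K] [NumberField K], poitouTate_selmerStructure_duality K)
    (hPT2 : ∀ (K : Type) [Field K] [NumberField K], poitouTate_sha_tateDual K)
    (hco : CornerCoStepLAt W) : CornerUpperAt W :=
  cornerUpperAt_of_coIMC_of_facts W hGZK hnf hPT hPT2
    (fun N _ K _ _ Dt H ι P hX hns _ hN hK hodd hHN hLt hP hc hPinf κ hκ γ _ 𝔭 h𝔭 he hf ↦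
      hco N K Dt H ι P hX hns hN hK hodd hHN hLt hP hc hPinf κ hκ γ 𝔭 h𝔭 he hf)

/-- **THE READING OF RECORD of `stub_cornerUpper3` along the co-chain: `Theorems.CornerAtThreeUpper` (p488767) ⟸
`Theorems.CornerAtThreeCoStepL` (p530129) + four cited facts.** CONDITIONAL; closes nothing.
[cite: JetchevSkinnerWan2017, §7.4.2 (eq:shaupper) (arXiv:1512.06894 p. 31)] -/
theorem cornerAtThreeUpper_of_cornerAtThreeCoStepL_of_facts [Fact (Nat.Prime 3)]
    (hGZK : rank_eq_analyticRank_of_analyticRank_le_one) (hnf : exists_isNewformOf)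
    (hPT : ∀ (K : Type) [Field K] [NumberField K], poitouTate_selmerStructure_duality K)
    (hPT2 : ∀ (K : Type) [Field K] [NumberField K], poitouTate_sha_tateDual K)
    (hco : Summit.BirchSwinnertonDyer.BirchSwinnertonDyer.Theorems.CornerAtThreeCoStepL) :
    Summit.BirchSwinnertonDyer.BirchSwinnertonDyer.Theorems.CornerAtThreeUpper :=
  fun W _ _ ↦ cornerUpperAt_of_cornerCoStepLAt_of_facts W hGZK hnf hPT hPT2 (hco W)

/-! ### §2. The converse on all corner frames (Matar–Nekovář on `3 ∤ ∏c`) and the `iff` -/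

/-- **`Three.CornerUpperAt W` ⟹ `Three.CornerCoStepLAt W`, modulo eight cited facts.** At a corner frame with
`3 ∣ ∏_ℓ c_ℓ(E)`: file 3's tightness (`cornerCoIMC_of_cornerUpperAt_of_facts`). At a corner frame with `3 ∤ ∏c`:
`Ш(E/K)` is finite (Gross–Zagier + Kolyvagin + modularity), the Tamagawa term has valuation `0`, and the UNSHARP
bound `ord₃ #Ш(E/K) ≤ 2·ord₃ [E(K):ℤP]` is the PRINTED image-free Kolyvagin bound of Matar–Nekovář 2019 Thm. 0.3
(`hMN`; (irr), `3 ≠ 2`, `d_K ∉ {−3,−4}` from `3` split in `K` and `d_K` odd); control turns it into the «⊇» half.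
[cite: MatarNekovar2019, Thm. 0.3 (p. 456) and §0.11 (p. 457)] [cite: Castella2018, Thm. 2.3 (p. 5), Thm. 3.2 (p. 9)]
[cite: Kolyvagin1990, Thm. A] -/
theorem cornerCoStepLAt_of_cornerUpperAt_of_facts [Fact (Nat.Prime 3)]
    (hGZ : ∀ (N : ℕ) [NeZero N] (W : WeierstrassCurve ℚ) (K : Type) [Field K] [NumberField K],
      gross_zagier N W K)
    (hKo : ∀ (N : ℕ) [NeZero N] (W : WeierstrassCurve ℚ) (K : Type) [Field K] [NumberField K],
      kolyvagin N W K)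
    (hmod : hasEntireLFunction_rat)
    (hGZK : rank_eq_analyticRank_of_analyticRank_le_one) (hnf : exists_isNewformOf)
    (hPT : ∀ (K : Type) [Field K] [NumberField K], poitouTate_selmerStructure_duality K)
    (hPT2 : ∀ (K : Type) [Field K] [NumberField K], poitouTate_sha_tateDual K)
    (hMN : ∀ (N : ℕ) [NeZero N] (W : WeierstrassCurve ℚ) (K : Type) [Field K] [NumberField K],
      MatarNekovar2019.thm03_padicValNat_card_sha_le_of_irreducible N W K)
    (hU : CornerUpperAt W) : CornerCoStepLAt W := by
  intro N _ K _ _ Dt H ι P hX hns hN hK hodd hHN hLt hP hc hPinf κ hκ γ _ 𝔭 h𝔭 he hf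
  by_cases ht : 3 ∣ W.tamagawaProduct
  · exact cornerCoIMC_of_cornerUpperAt_of_facts W hGZ hKo hmod hGZK hnf hPT hPT2 hU N K Dt H ι P hX hns ht hN hK
      hodd hHN hLt hP hc hPinf κ hκ γ 𝔭 h𝔭 he hf
  · obtain ⟨hr, hp2, hmult, hirr⟩ := id hX
    have hpN : 3 ∣ N := hN ▸ dvd_conductorNorm_of_mult hmult
    have hsplit : SplitsIn K 3 := hHN 3 Fact.out hpN
    haveI : Finite (W.baseChange K).sha :=
      finite_sha_baseChange_of_heegner W N K Dt H ι P (hGZ N W K) (hKo N W K) hmod hr hK hHN hLt hP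
    have hCTL : ControlOnTreeAt 3 κ 𝔭 γ (embAt K 3 𝔭 h𝔭 he hf) P :=
      controlOnTreeAt_of_mult_of_rankOne_odd W 3 hGZK hnf hPT hPT2 hp2 hmult hr hK hsplit hLt P hPinf κ hκ γ 𝔭 h𝔭
        he hf
    -- `d_K ∉ {−3, −4}`: `3 ∤ d_K` (3 splits) and `d_K` odd
    have hpd : ¬ (3 : ℤ) ∣ NumberField.discr K := not_dvd_discr_of_splitsIn hK.1 Fact.out hsplit
    have hD3 : NumberField.discr K ≠ -3 := by
      intro h; apply hpd; rw [h]; norm_num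
    have hD4 : NumberField.discr K ≠ -4 := by
      intro h; rw [h] at hodd; obtain ⟨k, hk⟩ := hodd; omega
    have hMNK := hMN N W K hK hHN hD3 hD4 ⟨Dt, H, ι, hP⟩ hPinf Fact.out hp2 hirr
    have ht0 : padicValNat 3 W.tamagawaProduct = 0 := padicValNat.eq_zero_of_not_dvd ht
    refine (coLink_iff_shaOrder_add_two_mul_tamagawa_le_of_controlOnTreeAt hK hN hHN hCTL).mpr ?_
    rw [ht0, mul_zero, add_zero, WeierstrassCurve.shaOrder]
    exact hMNK

/-- **`Three.CornerCoStepLAt W` ⟺ `Three.CornerUpperAt W` on the (T4″)@3 corner, modulo eight cited facts** (GZK,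
newforms, Poitou–Tate ×2 both ways; Gross–Zagier, Kolyvagin, modularity, Matar–Nekovář for the converse). The co-chain's
named input is EXACTLY the crux's conjunct 3. [cite: Castella2018, §5 (5.1)–(5.2) (arXiv:1704.06608 p. 12)]
[cite: MatarNekovar2019, Thm. 0.3 (p. 456)] -/
theorem cornerCoStepLAt_iff_cornerUpperAt_of_facts [Fact (Nat.Prime 3)]
    (hGZ : ∀ (N : ℕ) [NeZero N] (W : WeierstrassCurve ℚ) (K : Type) [Field K] [NumberField K],
      gross_zagier N W K)
    (hKo : ∀ (N : ℕ) [NeZero N] (W : WeierstrassCurve ℚ) (K : Type) [Field K] [NumberField K],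
      kolyvagin N W K)
    (hmod : hasEntireLFunction_rat)
    (hGZK : rank_eq_analyticRank_of_analyticRank_le_one) (hnf : exists_isNewformOf)
    (hPT : ∀ (K : Type) [Field K] [NumberField K], poitouTate_selmerStructure_duality K)
    (hPT2 : ∀ (K : Type) [Field K] [NumberField K], poitouTate_sha_tateDual K)
    (hMN : ∀ (N : ℕ) [NeZero N] (W : WeierstrassCurve ℚ) (K : Type) [Field K] [NumberField K],
      MatarNekovar2019.thm03_padicValNat_card_sha_le_of_irreducible N W K) :
    CornerCoStepLAt W ↔ CornerUpperAt W :=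
  ⟨cornerUpperAt_of_cornerCoStepLAt_of_facts W hGZK hnf hPT hPT2,
    cornerCoStepLAt_of_cornerUpperAt_of_facts W hGZ hKo hmod hGZK hnf hPT hPT2 hMN⟩

/-! ### §3. Conjunct 1 ∧ co-conjunct = the main conjecture EQUALITY at `𝟙` on the corner frames -/

/-- **`CornerStepLAt W ∧ CornerCoStepLAt W` ⟺ route R1's EQUALITY link `IMCWaldspurgerOnTreeAt` at every corner
frame** (`ord₃ f_ac(0) = 2(ord₃ log_ω P − 1)` for the constructed `X_ac`): the two inclusions of ONE anticyclotomic
BDP main conjecture at `𝟙` (`imcWaldspurgerOnTreeAt_iff_lower_and_upper`). Pure logic; nothing asserted.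
[cite: Castella2018, Thm. 3.2 (p. 9) and §5 (5.1) (p. 12) (shapes)] -/
theorem cornerStepL_and_coStepL_iff_imcWaldspurger [Fact (Nat.Prime 3)] :
    (CornerStepLAt W ∧ CornerCoStepLAt W) ↔
    ∀ (N : ℕ) [NeZero N] (K : Type) [Field K] [NumberField K]
      (Dt : ModularParametrizationData W N) (H : HeegnerDatum N (NumberField.discr K)) (ι : K →+* ℂ)
      (P : (W.baseChange K).toAffine.Point),
      ClassX11b W 3 → ¬ Surj W 3 → W.conductorNorm ℤ = N → IsImaginaryQuadratic K →
      Odd (NumberField.discr K) → SatisfiesHeegnerHypothesis N K →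
      (W.quadraticTwist (NumberField.discr K : ℚ)).entireLFunction 1 ≠ 0 →
      WeierstrassCurve.Affine.Point.map ι.toRatAlgHom P = heegnerPointComplex Dt H →
      ¬ (3 : ℤ) ∣ Dt.c → ¬ IsOfFinAddOrder P →
      ∀ (κ : ZpExtension K 3), κ.IsAnticyclotomic →
        ∀ (γ : Field.absoluteGaloisGroup K) [Fact (κ.IsTopGenerator γ)]
          (𝔭 : HeightOneSpectrum (𝓞 K)) (h𝔭 : ((3 : ℕ) : 𝓞 K) ∈ 𝔭.asIdeal)
          (he : 𝔭.asIdeal.ramificationIdx (𝓞 ℚ) = 1) (hf : 𝔭.asIdeal.inertiaDeg (𝓞 ℚ) = 1),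
          IMCWaldspurgerOnTreeAt 3 κ 𝔭 γ (embAt K 3 𝔭 h𝔭 he hf) P := by
  constructor
  · rintro ⟨hL, hU⟩ N _ K _ _ Dt H ι P hX hns hN hK hodd hHN hLt hP hc hPinf κ hκ γ _ 𝔭 h𝔭 he hf
    exact imcWaldspurgerOnTreeAt_iff_lower_and_upper.mpr
      ⟨hL N K Dt H ι P hX hns hN hK hodd hHN hLt hP hc hPinf κ hκ γ 𝔭 h𝔭 he hf,
        hU N K Dt H ι P hX hns hN hK hodd hHN hLt hP hc hPinf κ hκ γ 𝔭 h𝔭 he hf⟩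
  · intro h
    exact ⟨fun N _ K _ _ Dt H ι P hX hns hN hK hodd hHN hLt hP hc hPinf κ hκ γ _ 𝔭 h𝔭 he hf ↦
        (imcWaldspurgerOnTreeAt_iff_lower_and_upper.mp
          (h N K Dt H ι P hX hns hN hK hodd hHN hLt hP hc hPinf κ hκ γ 𝔭 h𝔭 he hf)).1,
      fun N _ K _ _ Dt H ι P hX hns hN hK hodd hHN hLt hP hc hPinf κ hκ γ _ 𝔭 h𝔭 he hf ↦
        (imcWaldspurgerOnTreeAt_iff_lower_and_upper.mp
          (h N K Dt H ι P hX hns hN hK hodd hHN hLt hP hc hPinf κ hκ γ 𝔭 h𝔭 he hf)).2⟩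

end Summit.BirchSwinnertonDyer.Rank1Residual.X11b.Three

end
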